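import Summits.BirchSwinnertonDyer.Rank1Residual.ManinAdditive.TwistOrbitDegreeIdentity
import Summits.BirchSwinnertonDyer.Rank1Residual.Additive.GordKodairaType
import Literature.NumberTheory.EllipticCurves.ManinConstantKodairaTypePrimes
import Literature.NumberTheory.EllipticCurves.ManinConstantNonPotentiallyOrdinaryPrimes
import Literature.NumberTheory.EllipticCurves.ManinConstantModularDegree
import Literature.NumberTheory.EllipticCurves.ManinConstantSemistablePrimewise
import HarnessLib

/-!
# Route `ManinLocalTwoThree`, residual crux C5 `ManinPrimeToAdditiveFiveLe`
# (stmt-BirchSwinnertonDyer-22969), line `upper_anchor`: STUB 2 `stub_reducibleTwistMinimal`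
# **CLOSED MODULO PRINT + two named cores** (Edixhoven 1991 Thm. 3, Česnavičius–Neururer–Saha Thm. 1.2)

The registered stub `stub_reducibleTwistMinimal` of the line skeleton
`Cruxes/ManinPrimeToAdditiveFiveLe/Lines/upper_anchor.lean` is crux C5 RESTRICTED to the
`W[p]`-REDUCIBLE, globally twist-minimal classes (no odd semistable `χ_{q*}`-untwist, no dyadic
semistable untwist) with a lattice-optimal conductor-level datum `D`, `p ≥ 5`, `p² ∣ N(W)`:
`p ∤ c(D)`. This file records, kernel-checked, how far PRINT reaches inside it — with no twist-orbit
machinery and no use of reducibility — and names exactly what is left: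

`reducibleTwistMinimal_of_edixhoven_cns_of_cores`: the registered signature VERBATIM follows from
* (i) Edixhoven 1991 Thm. 3, Kodaira-type half (`edixhoven_not_dvd_maninConstant_of_kodairaSymbol_ne`,
  cite-only): `p > 7`, Kodaira symbol at `p` not II/III/IV ⇒ `p ∤ c`;
* (ii) Edixhoven 1991 Thm. 3, ordinarity half (`edixhoven_not_dvd_maninConstant_of_not_potentiallyGoodOrdinary`,
  cite-only): `p > 7`, not potentially good ordinary at `p` in the (G)-shape ⇒ `p ∤ c`;
* (iii) Česnavičius–Neururer–Saha 2024 Thm. 1.2 (`cesnaviciusNeururerSaha_padicVal_maninConstant_le_modularDegree`,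
  cite-only; tree corollary `not_dvd_maninConstant_of_not_dvd_modularDegree`): at `p ≥ 5`,
  `p ∤ deg φ ⇒ p ∤ c`;
* core RED(57) (`h57`): the stub's own binders with `p ∈ {5, 7}` in place of `5 ≤ p` — Raynaud's
  `e < p − 1` fails, nothing in print (KP57 / Kosters–Pannekoek territory of route
  `EdixhovenFibreFiveSeven`);
* core RED(11) (`h11`): the stub's own binders with `7 < p`, PLUS `ord_p Δ_min(W) ≤ 4` (Kodaira II,
  III or IV at `p`), PLUS the (G)-ordinary `∃`-clause of fact (ii) (potentially good ordinary over a
  subfield of `ℚ(ζ_p)`), PLUS `p ∣ deg φ_D` — verbatim Edixhoven's printed exception («in that case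
  `p` divides `c` at most once») cut down by ČNS; met in Cremona's range by the `W[13]`-reducible
  `X₀(13)` family R₁₃ (lead's evidence #6 on 22969, e.g. `216320i1`: type II at `13`, ordinary,
  `13 ∣ deg φ`) and by the R₁₁,₁₇ list of the item's informal statement.

Proof: split `p ∈ {5,7}` / `p > 7`; at `p > 7`, `W` is additive at `p` (`p² ∣ N`,
`ManinAdditive.not_good_and_not_mult_of_sq_dvd_conductorNorm`), split on `ord_p Δ_min ≤ 4` — which
at an additive `p ≥ 5` is EQUIVALENT to Kodaira II/III/IV
(`Additive.kodairaSymbolAt_placeOf_II_or_III_or_IV_iff_of_addv`) — so the starred side is fact (i);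
on the unstarred side split on the (G)-clause (else fact (ii)) and on `p ∣ deg φ` (else fact (iii)).
This is the lead's EDIXHOVEN REDUCTION (p607525, seat bsd-line-ml23-c5-p1) run on stub 2's binders
with one more cut (ČNS), as allocated (HOME INBOX 2026-08-28T05:59:40Z, piece β′).

HONEST STATUS. Conditional-result, `--supports … --as helper`: facts (i)–(iii) are published
theorems NOT among C5's hypotheses, and the two cores are OPEN mathematics; the registered stub stays
`sorry`. Reducibility of `W[p]` is carried and never used: the same proof gives the unrestricted
statement, which is the lead's p607525 with the ČNS cut added. Nothing here proves BSD, Manin's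
conjecture or C5. Seat bsd-line-ml23-c5-p1-w2 (width prover).

References: [EdixhovenManin1991] Thm. 3; [CesnaviciusNeururerSaha2023] Thm. 1.2;
[AgasheRibetStein2006] §2; [SilvermanATAEC1994] IV Table 4.1; [Mazur1978] Thm. 1 (the R-lists).
-/

set_option autoImplicit false
-- the Theorems namespace of this sub repeats the summit name by design (D-0017 nested layout)
set_option linter.dupNamespace false

noncomputable section

open scoped Classical NumberField

namespace Summit.BirchSwinnertonDyer.BirchSwinnertonDyer.Theorems

open WeierstrassCurve IsDedekindDomain Rat.HeightOneSpectrum NumberField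
  Literature.NumberTheory.EllipticCurves Literature.NumberTheory.EllipticCurves.ModularForms
  Literature.NumberTheory.EllipticCurves.Rank1Residual
  Literature.NumberTheory.DiophantineGeometry
  Summit.BirchSwinnertonDyer.Rank1Residual.ManinAdditive
  Summit.BirchSwinnertonDyer.Rank1Residual.Additive

/-- **STUB 2 `stub_reducibleTwistMinimal` of line `upper_anchor` (crux C5 `ManinPrimeToAdditiveFiveLe`,
stmt-BirchSwinnertonDyer-22969) — registered signature VERBATIM as the conclusion — GRANTED
Edixhoven 1991 Thm. 3 (both cite-only halves `hK`, `hG`), Česnavičius–Neururer–Saha Thm. 1.2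
(`hCNS`) and the two OPEN cores RED(57) (`h57`: the stub at `p ∈ {5, 7}`) and RED(11) (`h11`: the
stub at `p > 7` on the unstarred, (G)-ordinary, `p ∣ deg φ` locus).** Conditional-result; the
`W[p]`-reducibility binder is carried, not used. [cite: EdixhovenManin1991, Thm. 3]
[cite: CesnaviciusNeururerSaha2023, Thm. 1.2] [cite: SilvermanATAEC1994, IV Table 4.1] -/
theorem reducibleTwistMinimal_of_edixhoven_cns_of_cores
    (hK : edixhoven_not_dvd_maninConstant_of_kodairaSymbol_ne)
    (hG : edixhoven_not_dvd_maninConstant_of_not_potentiallyGoodOrdinary)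
    (hCNS : cesnaviciusNeururerSaha_padicVal_maninConstant_le_modularDegree)
    (h57 : mazur_not_dvd_maninConstant_of_odd → abbesUllmo_not_dvd_maninConstant_of_not_dvd_level →
      cesnavicius_not_two_dvd_maninConstant_of_two_dvd_level → exists_isNewformOf →
      ∀ (W : WeierstrassCurve ℚ) [W.IsElliptic] [W.IsGloballyMinimal] [NeZero (W.conductorNorm ℤ)]
        (D : ModularParametrizationData W (W.conductorNorm ℤ)),
        IsLatticeOptimal D → ∀ p : ℕ, p.Prime → (p = 5 ∨ p = 7) → p ^ 2 ∣ W.conductorNorm ℤ →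
        ¬ (∃ (W' : WeierstrassCurve ℚ) (q : ℕ), W'.IsElliptic ∧ W'.IsGloballyMinimal ∧ q.Prime ∧
            q ≠ 2 ∧ q ^ 2 ∣ W.conductorNorm ℤ ∧
            IsIsogenous W (W'.quadraticTwist (((-1 : ℤ) ^ (q / 2) * q : ℤ) : ℚ)) ∧
            ¬ q ^ 2 ∣ W'.conductorNorm ℤ) →
        ¬ (∃ (W' : WeierstrassCurve ℚ) (d : ℤ), W'.IsElliptic ∧ W'.IsGloballyMinimal ∧
            (d = -1 ∨ d = 2 ∨ d = -2) ∧ 2 ^ 2 ∣ W.conductorNorm ℤ ∧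
            IsIsogenous W (W'.quadraticTwist (d : ℚ)) ∧ ¬ 2 ^ 2 ∣ W'.conductorNorm ℤ) →
        ¬ W.HasIrreducibleModPGaloisRep p →
        ¬ (p : ℤ) ∣ D.maninConstant)
    (h11 : mazur_not_dvd_maninConstant_of_odd → abbesUllmo_not_dvd_maninConstant_of_not_dvd_level →
      cesnavicius_not_two_dvd_maninConstant_of_two_dvd_level → exists_isNewformOf →
      ∀ (W : WeierstrassCurve ℚ) [W.IsElliptic] [W.IsGloballyMinimal] [NeZero (W.conductorNorm ℤ)]
        (D : ModularParametrizationData W (W.conductorNorm ℤ)),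
        IsLatticeOptimal D → ∀ p : ℕ, p.Prime → 7 < p → p ^ 2 ∣ W.conductorNorm ℤ →
        ¬ (∃ (W' : WeierstrassCurve ℚ) (q : ℕ), W'.IsElliptic ∧ W'.IsGloballyMinimal ∧ q.Prime ∧
            q ≠ 2 ∧ q ^ 2 ∣ W.conductorNorm ℤ ∧
            IsIsogenous W (W'.quadraticTwist (((-1 : ℤ) ^ (q / 2) * q : ℤ) : ℚ)) ∧
            ¬ q ^ 2 ∣ W'.conductorNorm ℤ) →
        ¬ (∃ (W' : WeierstrassCurve ℚ) (d : ℤ), W'.IsElliptic ∧ W'.IsGloballyMinimal ∧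
            (d = -1 ∨ d = 2 ∨ d = -2) ∧ 2 ^ 2 ∣ W.conductorNorm ℤ ∧
            IsIsogenous W (W'.quadraticTwist (d : ℚ)) ∧ ¬ 2 ^ 2 ∣ W'.conductorNorm ℤ) →
        ¬ W.HasIrreducibleModPGaloisRep p →
        padicValInt p W.minimalDiscriminantInt ≤ 4 →
        (∃ (L : Type) (_ : Field L) (_ : NumberField L) (_ : IsCyclotomicExtension {p} ℚ L)
            (F : IntermediateField ℚ L),
            ∀ w : HeightOneSpectrum (𝓞 F), (p : 𝓞 F) ∈ w.asIdeal →
              (W.baseChange F).HasGoodReductionAt w ∧ (W.baseChange F).HasUnitRootAt w) →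
        p ∣ D.modularDegree →
        ¬ (p : ℤ) ∣ D.maninConstant) :
    mazur_not_dvd_maninConstant_of_odd → abbesUllmo_not_dvd_maninConstant_of_not_dvd_level →
    cesnavicius_not_two_dvd_maninConstant_of_two_dvd_level → exists_isNewformOf →
    ∀ (W : WeierstrassCurve ℚ) [W.IsElliptic] [W.IsGloballyMinimal] [NeZero (W.conductorNorm ℤ)]
      (D : ModularParametrizationData W (W.conductorNorm ℤ)),
      IsLatticeOptimal D → ∀ p : ℕ, p.Prime → 5 ≤ p → p ^ 2 ∣ W.conductorNorm ℤ →
      ¬ (∃ (W' : WeierstrassCurve ℚ) (q : ℕ), W'.IsElliptic ∧ W'.IsGloballyMinimal ∧ q.Prime ∧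
          q ≠ 2 ∧ q ^ 2 ∣ W.conductorNorm ℤ ∧
          IsIsogenous W (W'.quadraticTwist (((-1 : ℤ) ^ (q / 2) * q : ℤ) : ℚ)) ∧
          ¬ q ^ 2 ∣ W'.conductorNorm ℤ) →
      ¬ (∃ (W' : WeierstrassCurve ℚ) (d : ℤ), W'.IsElliptic ∧ W'.IsGloballyMinimal ∧
          (d = -1 ∨ d = 2 ∨ d = -2) ∧ 2 ^ 2 ∣ W.conductorNorm ℤ ∧
          IsIsogenous W (W'.quadraticTwist (d : ℚ)) ∧ ¬ 2 ^ 2 ∣ W'.conductorNorm ℤ) →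
      ¬ W.HasIrreducibleModPGaloisRep p →
      ¬ (p : ℤ) ∣ D.maninConstant := by
  intro hM hAU hC hnf W _ _ _ D hD p hp h5 hpN hodd hdy hred
  haveI hpF : Fact p.Prime := ⟨hp⟩
  by_cases h57p : p = 5 ∨ p = 7
  · exact h57 hM hAU hC hnf W D hD p hp h57p hpN hodd hdy hred
  · -- a prime `p ≥ 5` other than `5, 7` exceeds `7`
    have h7 : 7 < p := by
      obtain ⟨hp5, hp7⟩ := not_or.mp h57p
      have hp6 : p ≠ 6 := by rintro rfl; norm_num at hp
      omega
    -- `W` is additive at `p`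
    have hadd : Addv W p := not_good_and_not_mult_of_sq_dvd_conductorNorm W hpN
    by_cases hlow : padicValInt p W.minimalDiscriminantInt ≤ 4
    · -- unstarred (Kodaira II / III / IV): split on the (G)-ordinary clause, then on `p ∣ deg φ`
      by_cases hGo : ∃ (L : Type) (_ : Field L) (_ : NumberField L)
          (_ : IsCyclotomicExtension {p} ℚ L) (F : IntermediateField ℚ L),
          ∀ w : HeightOneSpectrum (𝓞 F), (p : 𝓞 F) ∈ w.asIdeal →
            (W.baseChange F).HasGoodReductionAt w ∧ (W.baseChange F).HasUnitRootAt w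
      · by_cases hdeg : p ∣ D.modularDegree
        · exact h11 hM hAU hC hnf W D hD p hp h7 hpN hodd hdy hred hlow hGo hdeg
        · exact not_dvd_maninConstant_of_not_dvd_modularDegree hCNS W D hp h5 hdeg
      · exact hG W D hD p hp h7 hGo
    · -- starred (Kodaira I₀*/Iₙ*/IV*/III*/II*, `ord_p Δ_min > 4`): the Kodaira-type fact
      have hnot : ¬ (W.kodairaSymbolAt (placeOf p) = .II ∨ W.kodairaSymbolAt (placeOf p) = .III ∨
          W.kodairaSymbolAt (placeOf p) = .IV) :=
        fun h ↦ hlow ((kodairaSymbolAt_placeOf_II_or_III_or_IV_iff_of_addv W p h5 hadd).mp h)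
      have h2 : W.kodairaSymbolAt (placeOf p) ≠ .II := fun h ↦ hnot (Or.inl h)
      have h3 : W.kodairaSymbolAt (placeOf p) ≠ .III := fun h ↦ hnot (Or.inr (Or.inl h))
      have h4 : W.kodairaSymbolAt (placeOf p) ≠ .IV := fun h ↦ hnot (Or.inr (Or.inr h))
      exact hK W D hD p hp h7 h2 h3 h4

end Summit.BirchSwinnertonDyer.BirchSwinnertonDyer.Theorems

end
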